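import Literature.AlgebraicGeometry.HodgeTheory.CycleClassPushforward
import HarnessLib

/-!
# The rank of a degree-`k` morphism over its finite flat locus is `k`

Family `hodge`, layer `Literature/AlgebraicGeometry/HodgeTheory`. For a morphism `q : T ⟶ W` of
smooth projective `d`-folds over `ℂ` of degree `k ≥ 1` in the sense of cycles,
`q_*[T] = k • [W]` (so `q` is dominant and `k = [K(T) : K(W)] = [κ(θ) : κ(ω)]` for the generic
points `θ`, `ω`), and an open `U ∋ ω` of `W` over which `q` is finite and flat, the rank of the
finite locally free `𝒪_U`-module `q_* 𝒪_{q⁻¹U}` (Mathlib `Scheme.Hom.finrank`, Stacks 02KA) is `k`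
at every point of `U` (Fulton, *Intersection Theory*, Example 1.7.4: a finite flat `f : X' → X`
"has degree `d`" when `f_*𝒪_{X'}` is locally free of rank `d`; for varieties `d = [R(X') : R(X)]`).

Proof: the rank is locally constant (Mathlib `Scheme.Hom.isLocallyConstant_finrank`), hence
constant on the irreducible `U`, and at the generic point `ω` the fibre of `q ∣_ U` is the single
point `θ` (the fibres of a finite morphism are discrete and every point of `q⁻¹U` is a
specialisation of `θ`), of multiplicity `ℓ(𝒪_{T_ω, θ}) = 1` (`ℓ(𝒪_{T,θ}) = ℓ(𝒪_{W,ω}) · ℓ(𝒪_{T_ω,θ})`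
for the flat `q`, Fulton Lemma A.4.1, with `ℓ = 1` at the generic points of the integral `T`, `W`)
and residue degree `[κ(θ) : κ(ω)] = k`; the fibre formula
`Σ_{x ↦ y} ℓ(𝒪_{X_y,x}) [κ(x):κ(y)] = rank_y f_*𝒪_X` (`Motives.finsum_stalkLength_mul_residueDegree_eq_finrank`)
concludes.

* `residueDegree_morphismRestrict` — residue degrees do not change under restriction to opens.
* `finrank_eq_residueDegree_genericPoint` — a finite flat morphism of integral schemes mapping
  generic point to generic point has constant rank `[κ(θ) : κ(ω)]`.
* `finrank_morphismRestrict_eq_of_map_primeCycle_eq_nsmul` — the statement above.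

## References

* [Fulton1998] W. Fulton, Intersection Theory, 2nd ed., Springer 1998, Example 1.7.4, §1.4,
  Lemma A.4.1.
* [StacksProject] The Stacks project, Tag 02KA (rank of a finite locally free morphism).
-/

noncomputable section

open CategoryTheory CategoryTheory.Limits AlgebraicGeometry Order

universe u

namespace Literature.AlgebraicGeometry.HodgeTheory

section General

variable {X Y : Scheme.{u}}

/-- Residue fields, hence residue degrees `[κ(x) : κ(f x)]`, are unchanged by restricting a
morphism over an open subset of the target (open immersions induce isomorphisms on residue
fields). [folklore] -/
theorem residueDegree_morphismRestrict (f : X ⟶ Y) (U : Y.Opens) (x : ↥(f ⁻¹ᵁ U)) :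
    (f ∣_ U).residueDegree x = f.residueDegree x.1 := by
  have h1 := Motives.residueDegree_comp (f ∣_ U) U.ι x
  rw [morphismRestrict_ι, Motives.residueDegree_comp,
    Motives.residueDegree_eq_one_of_surjectiveOnStalks U.ι,
    Motives.residueDegree_eq_one_of_surjectiveOnStalks (f ⁻¹ᵁ U).ι, one_mul, mul_one] at h1
  exact h1.symm

/-- Over the generic point `ω` of an irreducible scheme, a finite morphism from an irreducible
scheme whose generic point `θ` maps to `ω` has the single point `θ` in its fibre (the fibres of a
finite morphism are discrete, and every point is a specialisation of `θ`). [folklore] -/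
theorem preimage_singleton_genericPoint_eq (f : X ⟶ Y) [IsFinite f] [IrreducibleSpace X]
    [IrreducibleSpace Y] (hf : f.base (genericPoint X) = genericPoint Y) :
    f.base ⁻¹' {genericPoint Y} = {genericPoint X} := by
  ext x
  simp only [Set.mem_preimage, Set.mem_singleton_iff]
  refine ⟨fun hx ↦ ?_, fun hx ↦ hx ▸ hf⟩
  symm
  exact (f.isDiscrete_preimage_singleton (genericPoint Y)).eq_of_specializes
    (genericPoint_specializes x) hf hx

/-- **The rank of a finite flat morphism of integral schemes is the degree of the residue field
extension at the generic points.** For `f : X ⟶ Y` finite, flat and locally of finite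
presentation between integral schemes with `f θ = ω` (`θ`, `ω` the generic points),
`rank_y (f_* 𝒪_X) = [κ(θ) : κ(ω)]` for every `y ∈ Y`: the rank is locally constant (Stacks 02KA),
hence constant on the irreducible `Y`, and over `ω` the fibre is `{θ}` with multiplicity
`ℓ(𝒪_{X_ω, θ}) = 1` (`ℓ(𝒪_{X,θ}) = ℓ(𝒪_{Y,ω}) ℓ(𝒪_{X_ω,θ})`, Fulton Lemma A.4.1), so the fibre
formula `Σ_{x ↦ ω} ℓ(𝒪_{X_ω,x}) [κ(x) : κ(ω)] = rank_ω` gives the claim.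
[cite: Fulton1998, Example 1.7.4] [cite: StacksProject, Tag 02KA] -/
theorem finrank_eq_residueDegree_genericPoint (f : X ⟶ Y) [IsFinite f] [Flat f]
    [LocallyOfFinitePresentation f] [IsIntegral X] [IsIntegral Y]
    (hf : f.base (genericPoint X) = genericPoint Y) (y : Y) :
    f.finrank y = f.residueDegree (genericPoint X) := by
  -- the rank is constant on the irreducible `Y`
  have h1 : f.finrank y = f.finrank (genericPoint Y) :=
    f.isLocallyConstant_finrank.apply_eq_of_isPreconnected isPreconnected_univ
      (Set.mem_univ _) (Set.mem_univ _)
  rw [h1]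
  -- the fibre formula over the generic point has the single summand at `θ`
  have h2 := Motives.finsum_stalkLength_mul_residueDegree_eq_finrank f (genericPoint Y)
  rw [preimage_singleton_genericPoint_eq f hf, finsum_mem_singleton] at h2
  -- multiplicity one: `ℓ(𝒪_{X,θ}) = ℓ(𝒪_{Y,ω}) ℓ(𝒪_{X_ω,θ})` with both outer lengths `1`
  have h3 := Motives.stalkLength_eq_mul_stalkLength_fiber f (genericPoint X)
  have h4 : Motives.stalkLength Y (f.base (genericPoint X)) = 1 := by
    rw [hf]
    exact Motives.stalkLength_genericPoint Y
  rw [Motives.stalkLength_genericPoint X, h4, one_mul] at h3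
  rw [← h3, Nat.cast_one, one_mul] at h2
  exact_mod_cast h2.symm

end General

section HodgeTheory

/-- **The rank of a degree-`k` morphism over its finite flat locus is `k`.** For `q : T ⟶ W`
between smooth projective `d`-folds over `ℂ` with `q_*[T] = k • [W]` as cycles (`k ≥ 1`; `θ`, `ω`
the generic points) and an open `U ∋ ω` over which `q` is finite and flat, the rank of
`(q ∣_ U)_* 𝒪` is `k` at every point of `U`: `q θ = ω` and `[κ(θ) : κ(ω)] = k` by the cycle
equation (Fulton §1.4, `f_*[V] = deg(V/f V) [f V]`), and
`finrank_eq_residueDegree_genericPoint` for `q ∣_ U`.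
[cite: Fulton1998, Example 1.7.4] [cite: StacksProject, Tag 02KA] -/
theorem finrank_morphismRestrict_eq_of_map_primeCycle_eq_nsmul :
    ∀ ⦃d : ℕ⦄ ⦃T W : Motives.SchemeOver ℂ⦄ (hT : Motives.IsSmoothProjective d T)
      (hW : Motives.IsSmoothProjective d W) (q : T ⟶ W) [QuasiCompact q.left] ⦃θ : T.left⦄
      ⦃ω : W.left⦄,
      IsGenericPoint θ Set.univ → IsGenericPoint ω Set.univ → ∀ ⦃k : ℕ⦄, 0 < k →
      AlgebraicCycle.map q.left Order.height Order.height (Motives.primeCycle θ) =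
        k • Motives.primeCycle ω →
      ∀ (U : W.left.Opens), ω ∈ U → ∀ [IsFinite (q.left ∣_ U)] [Flat (q.left ∣_ U)],
        ∀ u : ↥U, (q.left ∣_ U).finrank u = k := by
  intro d T W hT hW q _ θ ω hθ hω k hk hq U hωU _ _ u
  classical
  have hk0 : k ≠ 0 := Nat.pos_iff_ne_zero.mp hk
  -- bookkeeping from the cycle equation: `q θ = ω` and `[κ(θ) : κ(ω)] = k`
  have hqθ : q.left.base θ = ω := base_eq_of_map_primeCycle_eq_nsmul q hk0 hq
  have hres : q.left.residueDegree θ = k := by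
    have hh : height ω = height θ := height_eq_of_map_primeCycle_eq_nsmul q hk0 hq
    have h1 := congrArg (fun c : AlgebraicCycle W.left ℤ ↦ c ω) hq
    simp only [Motives.algebraicCycleMap_primeCycle_eq_nsmul,
      Function.locallyFinsuppWithin.coe_nsmul, Pi.smul_apply, hqθ,
      Motives.primeCycle_apply_self, nsmul_eq_mul, mul_one, AlgebraicCycle.mapCoeff,
      if_pos hh.symm] at h1
    exact_mod_cast h1
  -- integrality and generic points
  haveI : IsIntegral T.left := Motives.IsSmoothProjective.isIntegral_holds hT
  haveI : IsIntegral W.left := Motives.IsSmoothProjective.isIntegral_holds hW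
  haveI : IsLocallyNoetherian W.left := Motives.IsSmoothProjective.isLocallyNoetherian_holds hW
  have hθg : θ = genericPoint T.left := hθ.eq (genericPoint_spec _)
  have hωg : ω = genericPoint W.left := hω.eq (genericPoint_spec _)
  have hθU : θ ∈ q.left ⁻¹ᵁ U := by
    change q.left.base θ ∈ U
    rw [hqθ]
    exact hωU
  haveI : Nonempty (U : Scheme) := ⟨(⟨ω, hωU⟩ : ↥U)⟩
  haveI : Nonempty (q.left ⁻¹ᵁ U : Scheme) := ⟨(⟨θ, hθU⟩ : ↥(q.left ⁻¹ᵁ U))⟩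
  haveI : IsIntegral (U : Scheme) := isIntegral_of_isOpenImmersion U.ι
  haveI : IsIntegral (q.left ⁻¹ᵁ U : Scheme) := isIntegral_of_isOpenImmersion (q.left ⁻¹ᵁ U).ι
  have hθ' : (⟨θ, hθU⟩ : ↥(q.left ⁻¹ᵁ U)) = genericPoint (q.left ⁻¹ᵁ U : Scheme) := by
    apply (q.left ⁻¹ᵁ U).ι.isOpenEmbedding.injective
    rw [Scheme.Opens.ι_apply, genericPoint_eq_of_isOpenImmersion (q.left ⁻¹ᵁ U).ι]
    exact hθg
  have hω' : (⟨ω, hωU⟩ : ↥U) = genericPoint (U : Scheme) := by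
    apply U.ι.isOpenEmbedding.injective
    rw [Scheme.Opens.ι_apply, genericPoint_eq_of_isOpenImmersion U.ι]
    exact hωg
  have hf : (q.left ∣_ U).base (genericPoint (q.left ⁻¹ᵁ U : Scheme)) =
      genericPoint (U : Scheme) := by
    rw [← hθ', ← hω']
    apply Subtype.ext
    rw [morphismRestrict_base_coe]
    exact hqθ
  -- `q ∣_ U` is locally of finite presentation (finite type over the locally Noetherian `U`)
  haveI : LocallyOfFinitePresentation (q.left ∣_ U) := inferInstance
  rw [finrank_eq_residueDegree_genericPoint (q.left ∣_ U) hf u, ← hθ',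
    residueDegree_morphismRestrict]
  exact hres

end HodgeTheory

end Literature.AlgebraicGeometry.HodgeTheory

end
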